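import Summits.Ventures.PercRepro.MSTightConjTAlpha

/-!
# Conjecture (T) when one side has a single partnerless member

Dossier proofs/MINE1-theoremS.md, Addendum 45 (supplement 2). Trace `P = proj r F` tight and
twin-free, `R = Rstar P`, `D = D(P)` (a down-set). The realisation lemmas of MSTightConjTAlpha put
`z = t ∖ s ∈ Y` into `X` as soon as some member of `P` disjoint from `z` lies in `F₁`, or some
member of `P` containing `z` lies in `F₀`. Members of `P` available (by `mem_iff_parts`):
* disjoint from `z`: `s ∩ R`, and `((p ∖ R) ∖ z) ∪ s` for every `p ∈ P` once `s ⊆ R`;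
* containing `z`: `t ∪ R`, and `z ∪ (p ∩ R)` for every `p ∈ P`.
If `P₀ = F₀ ∖ F₁` has at most one member, every member of `P` other than `s` lies in `F₁`, so the
first list proves `z ∈ X` unless `s ⊆ R` and `p ∖ R ⊆ z` for every `p` — then the full support
of the trace gives `t ∪ R = univ.erase r ∈ P`, i.e. `S ∖ r ∈ F` or `S ∈ F`
(`diffsY_subset_diffsX_of_part0_subsingleton`). If `P₁ = F₁ ∖ F₀` has at most one member, the
second list proves `z ∈ X` unless `R ⊆ t` and `t = z ∪ (p ∩ R)` for every `p` — then the empty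
core of the trace gives `R ⊆ z`, so `s ∩ R = ∅ ∈ P`, i.e. `{r} ∈ F` or `∅ ∈ F`
(`diffsY_subset_diffsX_of_partr_subsingleton`). No excess hypothesis, no case of the split.
On the census these two theorems cover exactly the case-(β) configurations left open by
MSTightConjTBeta / MSTightConjTBetaRes (the residue has `P₁ = {R*(F₁)}` or `P₀ = {R*(F₀)}`).
-/

namespace PercRepro.MSTight

open Finset
open scoped FinsetFamily

variable {α : Type*} [DecidableEq α] [Fintype α] {r : α} {F : Finset (Finset α)}

variable (hP : Tight (proj r F)) (htf : ∀ a b, Twin (proj r F) a b → a = b)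
include hP htf

omit htf in
/-- The addable part of a nonempty tight trace is a member of the trace, hence avoids `r`. -/
theorem Rstar_proj_mem_and_notMem (hne : (proj r F).Nonempty) :
    Rstar (proj r F) ∈ proj r F ∧ r ∉ Rstar (proj r F) := by
  have h : Rstar (proj r F) ∈ proj r F := Rstar_mem_of_dichotomy (dichotomy_of_tight hP) hne
  refine ⟨h, ?_⟩
  obtain ⟨B, _, hBe⟩ := mem_proj.1 h
  rw [← hBe]; exact notMem_erase r B

/-- **(T) when at most one `r`-free member is partnerless**, for a trace with full support and
`univ.erase r ∉ P` (i.e. `S ∖ r ∉ F` and `S ∉ F`). -/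
theorem diffsY_subset_diffsX_of_part0_subsingleton
    (hsupp : ∀ a, a ≠ r → ∃ p ∈ proj r F, a ∈ p) (hS : univ.erase r ∉ proj r F)
    (hsing : ∀ s ∈ part0 r F, s ∉ partr r F → ∀ s' ∈ part0 r F, s' ∉ partr r F → s = s') :
    diffsY r F ⊆ diffsX r F := by
  intro z hz
  obtain ⟨t, ht, s, hs, rfl⟩ := mem_diffs.1 hz
  by_cases hs1 : s ∈ partr r F
  · exact mem_union.2 (Or.inl (mem_union.2 (Or.inr (mem_diffs.2 ⟨t, ht, s, hs1, rfl⟩))))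
  by_cases ht0 : t ∈ part0 r F
  · exact mem_union.2 (Or.inl (mem_union.2 (Or.inl (mem_diffs.2 ⟨t, ht0, s, hs, rfl⟩))))
  by_contra hzX
  have hD : IsDownSet (proj r F \\ proj r F) := isDownSet_diffs_of_twinFree hP htf
  have hzD : t \ s ∈ proj r F \\ proj r F := diffsY_subset_diffs_proj' hz
  have htP : t ∈ proj r F := by rw [proj_eq_union]; exact mem_union_right _ ht
  have hsP : s ∈ proj r F := by rw [proj_eq_union]; exact mem_union_left _ hs
  have hempty : (∅ : Finset α) ∈ proj r F \\ proj r F :=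
    mem_diffs.2 ⟨t, htP, t, htP, Finset.sdiff_self t⟩
  set R := Rstar (proj r F) with hRdef
  obtain ⟨hRP, hrR⟩ := Rstar_proj_mem_and_notMem hP ⟨t, htP⟩
  obtain ⟨hs1', hs2'⟩ := (mem_iff_parts hP).1 hsP
  obtain ⟨ht1', _⟩ := (mem_iff_parts hP).1 htP
  -- a member of `P` other than `s` that is disjoint from `z` puts `z` into `X`
  have key : ∀ b ∈ proj r F, Disjoint b (t \ s) → b ≠ s → False := by
    intro b hbP hbz hbs
    rw [proj_eq_union, mem_union] at hbP
    rcases hbP with hb0 | hb1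
    · by_cases hb1 : b ∈ partr r F
      · exact hzX (sdiff_mem_diffsX_of_disjoint_mem_partr hP htf hz hb1 hbz.symm)
      · exact hbs (hsing b hb0 hb1 s hs hs1)
    · exact hzX (sdiff_mem_diffsX_of_disjoint_mem_partr hP htf hz hb1 hbz.symm)
  -- step 1: `s ⊆ R`
  have hsR : s ⊆ R := by
    by_contra hnot
    refine key (s ∩ R) ?_ ?_ ?_
    · rw [mem_iff_parts hP]
      refine ⟨?_, ?_⟩
      · rw [sdiff_eq_empty_iff_subset.2 inter_subset_right]; exact hempty
      · rw [sdiff_inter_self_right]; exact hs2'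
    · exact Finset.disjoint_left.2 fun x hx hx' => (mem_sdiff.1 hx').2 (mem_inter.1 hx).1
    · intro h
      apply hnot
      intro x hx
      have hx' : x ∈ s ∩ R := by rw [h]; exact hx
      exact (mem_inter.1 hx').2
  -- step 2: every member of `P` has `p ∖ R ⊆ z`
  have hall : ∀ p ∈ proj r F, p \ R ⊆ t \ s := by
    intro p hpP
    obtain ⟨hp1, _⟩ := (mem_iff_parts hP).1 hpP
    by_contra hnot
    refine key (((p \ R) \ (t \ s)) ∪ s) ?_ ?_ ?_
    · rw [mem_iff_parts hP]
      refine ⟨?_, ?_⟩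
      · refine hD _ hp1 _ ?_
        intro x hx
        simp only [mem_sdiff, mem_union] at hx ⊢
        rcases hx with ⟨h1 | h2, h3⟩
        · exact ⟨h1.1.1, h3⟩
        · exact absurd (hsR h2) h3
      · have e : R \ (((p \ R) \ (t \ s)) ∪ s) = R \ s := by
          ext x
          simp only [mem_sdiff, mem_union, not_or, not_and, not_not]
          tauto
        rw [e]; exact hs2'
    · rw [Finset.disjoint_left]
      intro x hx hx'
      rcases mem_union.1 hx with h | h
      · exact (mem_sdiff.1 h).2 hx'
      · exact (mem_sdiff.1 hx').2 h
    · intro h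
      apply hnot
      intro x hx
      by_contra hxz
      have hxb : x ∈ ((p \ R) \ (t \ s)) ∪ s := mem_union_left _ (mem_sdiff.2 ⟨hx, hxz⟩)
      rw [h] at hxb
      exact (mem_sdiff.1 hx).2 (hsR hxb)
  -- conclusion: `t ∪ R = univ.erase r ∈ P`
  apply hS
  have e : t ∪ R = univ.erase r := by
    ext a
    constructor
    · intro ha
      rw [mem_erase]
      refine ⟨?_, mem_univ a⟩
      rintro rfl
      rcases mem_union.1 ha with h | h
      · exact (mem_partr.1 ht).1 h
      · exact hrR h
    · intro ha
      have har : a ≠ r := (mem_erase.1 ha).1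
      by_cases haR : a ∈ R
      · exact mem_union_right _ haR
      · obtain ⟨p, hpP, hap⟩ := hsupp a har
        exact mem_union_left _ (mem_sdiff.1 (hall p hpP (mem_sdiff.2 ⟨hap, haR⟩))).1
  rw [← e, mem_iff_parts hP]
  refine ⟨?_, ?_⟩
  · rw [union_sdiff_right]; exact ht1'
  · rw [sdiff_eq_empty_iff_subset.2 subset_union_right]; exact hempty

/-- **(T) when at most one `r`-member is partnerless**, for a trace with empty core and
`∅ ∉ P` (i.e. `{r} ∉ F` and `∅ ∉ F`). -/
theorem diffsY_subset_diffsX_of_partr_subsingleton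
    (hcore : ∀ a, ∃ p ∈ proj r F, a ∉ p) (hE : (∅ : Finset α) ∉ proj r F)
    (hsing : ∀ t ∈ partr r F, t ∉ part0 r F → ∀ t' ∈ partr r F, t' ∉ part0 r F → t = t') :
    diffsY r F ⊆ diffsX r F := by
  intro z hz
  obtain ⟨t, ht, s, hs, rfl⟩ := mem_diffs.1 hz
  by_cases ht0 : t ∈ part0 r F
  · exact mem_union.2 (Or.inl (mem_union.2 (Or.inl (mem_diffs.2 ⟨t, ht0, s, hs, rfl⟩))))
  by_cases hs1 : s ∈ partr r F
  · exact mem_union.2 (Or.inl (mem_union.2 (Or.inr (mem_diffs.2 ⟨t, ht, s, hs1, rfl⟩))))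
  by_contra hzX
  have hD : IsDownSet (proj r F \\ proj r F) := isDownSet_diffs_of_twinFree hP htf
  have hzD : t \ s ∈ proj r F \\ proj r F := diffsY_subset_diffs_proj' hz
  have htP : t ∈ proj r F := by rw [proj_eq_union]; exact mem_union_right _ ht
  have hsP : s ∈ proj r F := by rw [proj_eq_union]; exact mem_union_left _ hs
  have hempty : (∅ : Finset α) ∈ proj r F \\ proj r F :=
    mem_diffs.2 ⟨t, htP, t, htP, Finset.sdiff_self t⟩
  set R := Rstar (proj r F) with hRdef
  obtain ⟨ht1', _⟩ := (mem_iff_parts hP).1 htP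
  obtain ⟨_, hs2'⟩ := (mem_iff_parts hP).1 hsP
  -- a member of `P` other than `t` containing `z` puts `z` into `X`
  have key : ∀ a ∈ proj r F, t \ s ⊆ a → a ≠ t → False := by
    intro a haP hza hat
    rw [proj_eq_union, mem_union] at haP
    rcases haP with ha0 | ha1
    · exact hzX (sdiff_mem_diffsX_of_superset_mem_part0 hP htf hz ha0 hza)
    · by_cases ha0 : a ∈ part0 r F
      · exact hzX (sdiff_mem_diffsX_of_superset_mem_part0 hP htf hz ha0 hza)
      · exact hat (hsing a ha1 ha0 t ht ht0)
  -- step 1: `R ⊆ t`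
  have hRt : R ⊆ t := by
    by_contra hnot
    refine key (t ∪ R) ?_ (sdiff_subset.trans subset_union_left) ?_
    · rw [mem_iff_parts hP]
      refine ⟨?_, ?_⟩
      · rw [union_sdiff_right]; exact ht1'
      · rw [sdiff_eq_empty_iff_subset.2 subset_union_right]; exact hempty
    · intro h
      exact hnot (fun x hx => (h ▸ mem_union_right t hx : x ∈ t))
  -- step 2: every member of `P` contains `R ∖ z`
  have hall : ∀ p ∈ proj r F, R \ (t \ s) ⊆ p := by
    intro p hpP
    obtain ⟨_, hp2⟩ := (mem_iff_parts hP).1 hpP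
    by_contra hnot
    refine key ((t \ s) ∪ (p ∩ R)) ?_ subset_union_left ?_
    · rw [mem_iff_parts hP]
      refine ⟨?_, ?_⟩
      · refine hD _ hzD _ ?_
        intro x hx
        rw [mem_sdiff, mem_union] at hx
        rcases hx with ⟨h1 | h2, h3⟩
        · exact h1
        · exact absurd (mem_inter.1 h2).2 h3
      · refine hD _ hp2 _ ?_
        intro x hx
        rw [mem_sdiff] at hx ⊢
        exact ⟨hx.1, fun hxp => hx.2 (mem_union_right _ (mem_inter.2 ⟨hxp, hx.1⟩))⟩
    · intro h
      apply hnot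
      intro x hx
      have hxt : x ∈ t := hRt (mem_sdiff.1 hx).1
      have hx' : x ∈ (t \ s) ∪ (p ∩ R) := by rw [h]; exact hxt
      rcases mem_union.1 hx' with h1 | h1
      · exact absurd h1 (mem_sdiff.1 hx).2
      · exact (mem_inter.1 h1).1
  -- conclusion: `R ⊆ z`, so `s ∩ R = ∅ ∈ P`
  have hRz : R ⊆ t \ s := by
    intro x hx
    by_contra hxz
    obtain ⟨p, hpP, hxp⟩ := hcore x
    exact hxp (hall p hpP (mem_sdiff.2 ⟨hx, hxz⟩))
  apply hE
  have e : s ∩ R = ∅ := by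
    ext x
    simp only [mem_inter, Finset.notMem_empty, iff_false, not_and]
    intro hxs hxR
    exact (mem_sdiff.1 (hRz hxR)).2 hxs
  rw [← e, mem_iff_parts hP]
  refine ⟨?_, ?_⟩
  · rw [sdiff_eq_empty_iff_subset.2 inter_subset_right]; exact hempty
  · rw [sdiff_inter_self_right]; exact hs2'

end PercRepro.MSTight
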